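import Summits.ResolutionOfSingularities.ResolutionOfSingularities.Theorems.PurelyInseparableDim4PointStepPackage
import Literature.AlgebraicGeometry.Resolution.MarkedIdealPointBlowup
import Literature.AlgebraicGeometry.Resolution.PointCentrePermissible
import Literature.AlgebraicGeometry.Resolution.BlowupSNC
import HarnessLib

/-!
# Purely inseparable four-folds: the LAST STEP of the point-centre walk on an arbitrary ambient — an isolated terminal
# state is resolved by one point blow-up (brick TY-3j part 4a, cell `res-dim4-pi`)

[OURS · counted 0] (D-0157 DOOR 2; general-ambient form of TY-3i for POINT centres, the closing step of the depth-`n` /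
ISOLATED-regime assembly; host item stmt-ResolutionOfSingularities-16155, helper). Nothing here proves resolution of
singularities in dimension ≥ 4 / characteristic `p`.

Setting: INVARIANT(Z, M, x₀) of `…PointStepPackage` (open-immersion chart `φ : 𝔸⁵_K ⟶ Z` at the closed `x₀` with
`M.ideal.comap φ = (z^p + F)·𝒪`, `mult M = p`, `F ≠ 0` clean, `p ≤ ord₀ F`), `Z` locally Noetherian.

* `natCast_le_ordZero_hyp_of_ordAlong_univ` — `p ≤ ord₀ F ⇒ p ≤ ord₀ (z^p + F)`;
* `le_idealOrder_of_chart` — hence `ord_{x₀} M.ideal ≥ p`: the chart centre is in `supp M`;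
* `support_vanishingIdeal_subset_support` — `{x₀} ⊆ supp M`;
* **`isMultipleBlowup_point`** — ANY blowing up of `x₀` is an admissible blow-up of `M` (BGMW Def. 3.1.3: the point is a
  regular centre inside `supp M` with snc with the boundary, tree `isRegular_subscheme_vanishingIdeal_singleton`,
  `HasSNC.hasSNCWith_vanishingIdeal_singleton`), given `HasSNC M.boundary`;
* `isRegular_of_isBlowup_point`, `jacobsonSpace_of_isBlowup'` — the blown-up ambient stays regular / Jacobson;
* **`support_transform_point_eq_empty`**, **`isMarkedResolution_point_of_no_edge`** — if moreover `Z` is regular and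
  Jacobson, `K = K̄`, `x₀` is the ONLY closed point of order `≥ p` (ISOLATED) and the walk has NO EDGE out of `s`
  (`∀ s', ¬ Edge p univ s s'`), then the transform has empty support and `π` is a marked resolution of `M`
  (`point_step_package` over `x₀`; `IsBlowup.idealOrder_controlledTransform_eq_of_not_mem` off `x₀`; TY-3g stop condition).

AI-produced formalisation, weaker than expert review. bears_on: LADDER-RESOLUTION:D157-DOOR2 (res-dim4-pi · TY-3j).
-/

set_option linter.dupNamespace false -- D-0017: single-problem summit path `Summit.<S>.<S>.…` by design

noncomputable section

open MvPolynomial Finset CategoryTheory AlgebraicGeometry Opposite TopologicalSpace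

namespace Summit.ResolutionOfSingularities.ResolutionOfSingularities.Theorems.PIDim4

open Literature.AlgebraicGeometry.Resolution
open Literature.AlgebraicGeometry.Resolution.Hauser2010
open Literature.AlgebraicGeometry.Resolution.AffinePointBlowup (P A γ coord Wtop ξ)

namespace Equimultiple

section LastStep

variable {K : Type} [Field K] {p : ℕ} [hp : Fact p.Prime] [CharP K p]
variable {Z W : Scheme.{0}} {π : W ⟶ Z} {x₀ : Z}

/-- `p ≤ ord₀ F` (all variables) gives `p ≤ ord₀ (z^p + F)`. [folklore] -/
theorem natCast_le_ordZero_hyp_of_ordAlong_univ [DecidableEq K] (F : MvPolynomial (Fin 4) K)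
    (hperm : (p : ℕ∞) ≤ CentreBlowup.ordAlong (Finset.univ : Finset (Fin 4)) F) :
    (p : ℕ∞) ≤ ordZero (PointBlowup.translate (Fin.cons 0 0 : Fin (4 + 1) → K) (hyp p F)) := by
  rw [natCast_le_ordZero_translate_hyp_iff, PointBlowup.translate_zero, zero_pow hp.out.ne_zero, zero_add]
  refine ⟨eval_eq_zero_of_one_le_ordAlong (le_trans (by exact_mod_cast hp.out.one_lt.le) hperm) fun _ _ => rfl,
    fun d _ hd => ?_⟩
  by_contra hne
  have hmem : d ∈ F.support := MvPolynomial.mem_support_iff.mpr hne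
  have h1 : (p : ℕ∞) ≤ (CentreBlowup.degIn Finset.univ d : ℕ∞) := hperm.trans (Finset.inf_le hmem)
  rw [CentreBlowup.degIn_univ] at h1
  exact absurd (by exact_mod_cast h1 : p ≤ d.degree) (not_le.mpr hd)

/-- **The chart centre lies in the support**: `ord_{x₀} M.ideal ≥ p`. [cite: Hauser2010, §F] -/
theorem le_idealOrder_of_chart [IsLocallyNoetherian Z] [DecidableEq K] (φ : P 4 K ⟶ Z) [IsOpenImmersion φ] (hφ : φ (ξ 4 K) = x₀)
    (M : MarkedIdeal Z) (s : State K) (hM : M.ideal.comap φ = hypSheaf p s.F)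
    (hperm : (p : ℕ∞) ≤ CentreBlowup.ordAlong (Finset.univ : Finset (Fin 4)) s.F) :
    (p : ℕ∞) ≤ idealOrder M.ideal x₀ := by
  have hξ : (ξ 4 K).asIdeal = MvPolynomial.vanishingIdeal K {(Fin.cons 0 0 : Fin (4 + 1) → K)} := by
    have hcons : (Fin.cons 0 0 : Fin (4 + 1) → K) = 0 := funext fun i => Fin.cases rfl (fun _ => rfl) i
    change originIdeal K (4 + 1) = _
    ext g
    rw [mem_originIdeal_iff, MvPolynomial.mem_vanishingIdeal_singleton_iff, hcons, MvPolynomial.aeval_zero]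
    exact Iff.rfl
  rw [← hφ, ← idealOrder_comap_of_isOpenImmersion φ M.ideal (ξ 4 K), hM,
    natCast_le_idealOrder_hypSheaf_iff _ hξ]
  exact natCast_le_ordZero_hyp_of_ordAlong_univ s.F hperm

/-- `{x₀} ⊆ supp M`. [cite: BierstoneGrigorievMilmanWlodarczyk2011, Def. 3.1.3 (3)] -/
theorem support_vanishingIdeal_subset_support [IsLocallyNoetherian Z] [DecidableEq K] (φ : P 4 K ⟶ Z) [IsOpenImmersion φ]
    (hx₀ : IsClosed ({x₀} : Set Z)) (hφ : φ (ξ 4 K) = x₀) (M : MarkedIdeal Z) (hmult : M.mult = p) (s : State K)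
    (hM : M.ideal.comap φ = hypSheaf p s.F)
    (hperm : (p : ℕ∞) ≤ CentreBlowup.ordAlong (Finset.univ : Finset (Fin 4)) s.F) :
    ((Scheme.IdealSheafData.vanishingIdeal (⟨{x₀}, hx₀⟩ : Closeds Z)).support : Set Z) ⊆ M.support := by
  intro y hy
  obtain rfl : y = x₀ := (mem_support_vanishingIdeal_singleton_iff hx₀).mp hy
  change (M.mult : ℕ∞) ≤ idealOrder M.ideal y
  rw [hmult]
  exact le_idealOrder_of_chart φ hφ M s hM hperm

/-- **ANY blowing up of the chart centre is an admissible blow-up of `M`** (BGMW Def. 3.1.3 (1)–(5)): a closed point is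
a regular centre, lies in `supp M`, and has snc with every snc boundary.
[cite: BierstoneGrigorievMilmanWlodarczyk2011, Def. 3.1.3] -/
theorem isMultipleBlowup_point [IsLocallyNoetherian Z] [DecidableEq K] (φ : P 4 K ⟶ Z) [IsOpenImmersion φ]
    (hx₀ : IsClosed ({x₀} : Set Z)) (hφ : φ (ξ 4 K) = x₀) (M : MarkedIdeal Z) (hmult : M.mult = p)
    (hE : HasSNC M.boundary) (s : State K) (hM : M.ideal.comap φ = hypSheaf p s.F)
    (hperm : (p : ℕ∞) ≤ CentreBlowup.ordAlong (Finset.univ : Finset (Fin 4)) s.F)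
    (hπ : IsBlowup π (Scheme.IdealSheafData.vanishingIdeal (⟨{x₀}, hx₀⟩ : Closeds Z))) :
    IsMultipleBlowup M π (M.transform π (Scheme.IdealSheafData.vanishingIdeal (⟨{x₀}, hx₀⟩ : Closeds Z))) :=
  IsMultipleBlowup.single M _ π hπ (isRegular_subscheme_vanishingIdeal_singleton hx₀)
    (support_vanishingIdeal_subset_support φ hx₀ hφ M hmult s hM hperm)
    (hE.hasSNCWith_vanishingIdeal_singleton hx₀)

omit hp [CharP K p] in
/-- The blow-up of a closed point with snc boundary is a regular scheme. [cite: Kollar2007, Def. 3.25] -/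
theorem isRegular_of_isBlowup_point [IsLocallyNoetherian Z] (hx₀ : IsClosed ({x₀} : Set Z)) {E : List Z.IdealSheafData} (hE : HasSNC E)
    (hπ : IsBlowup π (Scheme.IdealSheafData.vanishingIdeal (⟨{x₀}, hx₀⟩ : Closeds Z))) : Scheme.IsRegular W :=
  fun w => hπ.isRegularLocalRing_stalk_of_hasSNCWith (hE.hasSNCWith_vanishingIdeal_singleton hx₀) w

omit hp [CharP K p] in
/-- The blow-up of a Jacobson scheme is Jacobson (`π` is proper, hence locally of finite type).
[cite: StacksProject, Tag 01W0] -/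
theorem jacobsonSpace_of_isBlowup' [IsLocallyNoetherian Z] [JacobsonSpace Z] {C : Z.IdealSheafData} (hπ : IsBlowup π C) :
    JacobsonSpace W := by
  haveI : IsProper π := hπ.isProper
  exact LocallyOfFiniteType.jacobsonSpace π

omit hp [CharP K p] in
/-- `π w` is closed when `w` is (properness). [cite: StacksProject, Tag 01W0] -/
theorem isClosed_singleton_π' [IsLocallyNoetherian Z] {C : Z.IdealSheafData} (hπ : IsBlowup π C) {w : W} (hw : IsClosed ({w} : Set W)) :
    IsClosed ({π w} : Set Z) := by
  haveI : IsProper π := hπ.isProper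
  rw [← Set.image_singleton]
  exact π.isClosedMap _ hw

/-- **ISOLATED + NO EDGE ⇒ empty support after one point blow-up** (arbitrary ambient). [cite: Hauser2010, §F]
[cite: BierstoneGrigorievMilmanWlodarczyk2011, Def. 3.1.3 (6)] -/
theorem support_transform_point_eq_empty [IsLocallyNoetherian Z] [JacobsonSpace Z] [IsAlgClosed K] [DecidableEq K]
    (φ : P 4 K ⟶ Z) [IsOpenImmersion φ] (hx₀ : IsClosed ({x₀} : Set Z)) (hφ : φ (ξ 4 K) = x₀) (M : MarkedIdeal Z)
    (hmult : M.mult = p) (hE : HasSNC M.boundary) (s : State K) (hM : M.ideal.comap φ = hypSheaf p s.F)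
    (hF : s.F ≠ 0) (hclean : Literature.Barriers.ResolutionOfSingularities.HauserPerlega.IsClean p s.F)
    (hperm : (p : ℕ∞) ≤ CentreBlowup.ordAlong (Finset.univ : Finset (Fin 4)) s.F)
    (hπ : IsBlowup π (Scheme.IdealSheafData.vanishingIdeal (⟨{x₀}, hx₀⟩ : Closeds Z)))
    (hiso : ∀ z : Z, IsClosed ({z} : Set Z) → (p : ℕ∞) ≤ idealOrder M.ideal z → z = x₀)
    (hnoEdge : ∀ s' : State K, ¬ Edge p Finset.univ s s') :
    (M.transform π (Scheme.IdealSheafData.vanishingIdeal (⟨{x₀}, hx₀⟩ : Closeds Z))).support = ∅ := by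
  haveI : IsProper π := hπ.isProper
  haveI : IsLocallyNoetherian W := LocallyOfFiniteType.isLocallyNoetherian π
  haveI : JacobsonSpace W := jacobsonSpace_of_isBlowup' hπ
  rw [support_eq_empty_iff_forall_isClosed (isRegular_of_isBlowup_point hx₀ hE hπ)]
  intro w hw
  by_contra hge
  rw [not_lt] at hge
  change ((M.mult : ℕ) : ℕ∞) ≤ _ at hge
  rw [hmult] at hge
  by_cases hwx : π w = x₀
  · obtain ⟨j, b, -, hedge, -⟩ := point_step_package φ hx₀ hφ M hmult s hM hF hclean hperm hπ hw hwx hge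
    exact hnoEdge _ hedge
  · -- off `x₀` the blow-up is an isomorphism near `w`: the order is that of `M` at the closed point `π w`
    have hnot : π w ∉ ((Scheme.IdealSheafData.vanishingIdeal (⟨{x₀}, hx₀⟩ : Closeds Z)).support : Set Z) :=
      fun h => hwx ((mem_support_vanishingIdeal_singleton_iff hx₀).mp h)
    rw [MarkedIdeal.transform_ideal, hπ.idealOrder_controlledTransform_eq_of_not_mem _ hnot] at hge
    exact hwx (hiso (π w) (isClosed_singleton_π' hπ hw) hge)

/-- **THE LAST STEP (arbitrary ambient).** Under INVARIANT(Z, M, x₀) with `Z` locally Noetherian, regular-boundary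
(`HasSNC M.boundary`) and Jacobson, `K = K̄`: if `x₀` is the only closed point of order `≥ p` of `M` and the point-centre
walk has no edge out of `s`, then ANY blowing up of `x₀` is a MARKED RESOLUTION of `M` (BGMW Def. 3.1.3).
[cite: BierstoneGrigorievMilmanWlodarczyk2011, Def. 3.1.3] [cite: Hironaka1964, Main Theorem I (the characteristic-zero
statement whose analogue is asked)] -/
theorem isMarkedResolution_point_of_no_edge [IsLocallyNoetherian Z] [JacobsonSpace Z] [IsAlgClosed K]
    [DecidableEq K] (φ : P 4 K ⟶ Z) [IsOpenImmersion φ] (hx₀ : IsClosed ({x₀} : Set Z)) (hφ : φ (ξ 4 K) = x₀)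
    (M : MarkedIdeal Z) (hmult : M.mult = p) (hE : HasSNC M.boundary) (s : State K)
    (hM : M.ideal.comap φ = hypSheaf p s.F) (hF : s.F ≠ 0)
    (hclean : Literature.Barriers.ResolutionOfSingularities.HauserPerlega.IsClean p s.F)
    (hperm : (p : ℕ∞) ≤ CentreBlowup.ordAlong (Finset.univ : Finset (Fin 4)) s.F)
    (hπ : IsBlowup π (Scheme.IdealSheafData.vanishingIdeal (⟨{x₀}, hx₀⟩ : Closeds Z)))
    (hiso : ∀ z : Z, IsClosed ({z} : Set Z) → (p : ℕ∞) ≤ idealOrder M.ideal z → z = x₀)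
    (hnoEdge : ∀ s' : State K, ¬ Edge p Finset.univ s s') :
    IsMarkedResolution M π (M.transform π (Scheme.IdealSheafData.vanishingIdeal (⟨{x₀}, hx₀⟩ : Closeds Z))) :=
  ⟨isMultipleBlowup_point φ hx₀ hφ M hmult hE s hM hperm hπ,
    support_transform_point_eq_empty φ hx₀ hφ M hmult hE s hM hF hclean hperm hπ hiso hnoEdge⟩

end LastStep

end Equimultiple

end Summit.ResolutionOfSingularities.ResolutionOfSingularities.Theorems.PIDim4

end
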